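import Summits.HodgeConjecture.HodgeConjecture.Theorems.F0P6aSpecOrgansUBlockJ
import HarnessLib

/-!
# `F0P6aSpecOrgansURoofKernelUnique` — ★ RE-HOME of `Lines/F0_P6a_SpecOrgansU.lean` (tree sha16 c0cd5fc2e87636d7, 1347 l.), PART 2 of 5 — tree lines :367–:675
See PART 1 `Theorems/F0P6aSpecOrgansUBlockJ.lean` for the full ★ re-home header and the original module docstring (verbatim there).  Same namespace (every
fully-qualified name unchanged); the scopes open at the cut are re-opened below with their `variable` ∕ `open` ∕ `set_option` ∕ `universe` lines replayed verbatim
from the tree, in order; the code after the replay block is the tree bytes :367–:675, untouched except the (d1) cure named in PART 1.  HC_CM is proved only modulo the 7 printed citations (2 remaining: hLiu418 = stmt-HodgeConjecture-24832, h413 = stmt-HodgeConjecture-24833) until rung 0 closes; a re-home is count-neutral.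
-/

-- ── replay of the scopes open at tree line :367 (verbatim) ──
set_option autoImplicit false
set_option linter.dupNamespace false
noncomputable section
namespace Summit.HodgeConjecture.HodgeConjecture.Cruxes.HLiu418.F0P6aLineSpecialisation


/-! ## §C6Ω — § C6Ω (C6′-Ω) `roofKernel_eq_of_cw_eq` — LA6-p01 (g3) BY-IMPORT BLOCK v2 `RoofKernelUnique.partC.v2` 6a7e471b6746df10 :58–:661 (`universe u` + pre-namespace `open` + `section RoofKernelUnique`; `section CommGlue` ★-LIFTED to p851332 `KernelEqOfLagrangianBlocks`, the five glue call sites qualified `AffineGroupScheme.…`; `section QuotWDCore` + §2.0 Ω-helpers dropped per the DEDUP map) -/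

section Block_C6Ω

universe u
open CategoryTheory CategoryTheory.Limits AlgebraicGeometry MonoidalCategory CartesianMonoidalCategory
open scoped MonObj
open Literature.AlgebraicGeometry.Motives Literature.AlgebraicGeometry.GroupSchemes Literature.AlgebraicGeometry.GroupSchemes.GroupSchemeKernel
open Literature.AlgebraicGeometry.GroupSchemes.AffineGroupScheme Literature.AlgebraicGeometry.GroupSchemes.TorsionLayer
/-! ### §2 THE (C6′-Ω) ORGAN AT THE GENERIC FIBRE `A_y` -/

section RoofKernelUnique

set_option backward.isDefEq.respectTransparency false

open NumberField IsDedekindDomain MulAction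
open scoped Matrix Pointwise
open Literature.NumberTheory.GaloisRepresentations
open Literature.NumberTheory.Automorphic Literature.NumberTheory.Automorphic.UnitaryGroup
open Literature.AlgebraicGeometry.ShimuraVarieties.UnitaryCanonicalModel
open Literature.NumberTheory.Automorphic.Liu2021.AppendixC
open Literature.AlgebraicGeometry.Motives (AlgPoints IntegralModel SchemeOver thickening thickeningGalAction thickeningLift specOver)
open Literature.NumberTheory.DiophantineGeometry (geomResidueField specialFibreFunctor specResidueField)
open Literature.NumberTheory.EllipticCurves (specGenericPoint)
open Literature.AlgebraicGeometry.RelativeSpec (ActionOver)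
open Literature.AlgebraicGeometry.AbelianSchemes Literature.AlgebraicGeometry.AbelianSchemes.AbelianSchemeOver
open Summit.HodgeConjecture.HodgeConjecture.Cruxes.HLiu418.F0P6aModuliDatumDefs
open Summit.HodgeConjecture.HodgeConjecture.Cruxes.HLiu418.F0P6aRGDAssembly
open Summit.HodgeConjecture.HodgeConjecture.Cruxes.HLiu418.F0P6aDatumOfInputs

-- the D-line `Letters` frame VERBATIM (upstairs only: no `[IsGalois ℚ F]`, no `[ExpChar …]`)
variable {F : Type} [Field F] [NumberField F] [IsCMField F] {ι₁ : F →+* ℂ}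
    {Jstar : Matrix (Fin 2) (Fin 2) F}
    {K₀ : C5.OpenCompactSubgroup ↥(finAdelic ↥(maximalRealSubfield F) F (IsCMField.complexConj F) 2 Jstar)}
    {S : RecordSystemGS F Jstar ι₁ K₀} {hU7ₛ : S.HeckeTranslateDefinedOver}
    {hJ : (Jstar.map (IsCMField.complexConj F))ᵀ = Jstar} {hJu : IsUnit Jstar}
    {Fi : Type} [Field Fi] [Algebra F Fi] {Kc : C5.SmallLevel K₀} {G : Type} [Group G]
    {𝓜 : IntegralModel (𝓞 F) F ((thickening F Fi).obj (S.M.obj Kc))}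
    {w : HeightOneSpectrum (𝓞 F)} {hw : (IsCMField.complexConj F) • w ≠ w} {h𝓨 : (𝓜.localise w).IsSmoothProper 1}
    {θ : ActionOver (𝓜.localise w).total.hom ((Fi ≃ₐ[F] Fi) × G)}
    {e : Fi →ₐ[F] AlgebraicClosure (w.adicCompletion F)}

/-! #### §2.A THE UPSTAIRS LEGS ARE ISOGENIES (LA1-p01 (g3) `QuotLegReduction.v2` dd38f771 :69 BY COPY = «L3» W1 §3 (a), with the `hD` binder REPLACED by the fibre's polarisation pin — primed name) -/

set_option maxHeartbeats 400000 in
/-- (a) **THE UPSTAIRS LEGS ARE ISOGENIES** (★ `roof_legs_isFinite_surjective_of_polarization` at the D-line carriers): from (r2), (r3)-q, `c` surjective, `I.relDim` and `p ∈ 𝔭_w`.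
[cite: MumfordAV1970, §19 Thm. 1 (p. 174)] [cite: GortzWedhorn2023, Prop. 27.176 and Cor. 27.177] -/
theorem roofΩ_legs_isFinite_surjective' (I : RGDInputsAt F ι₁ Jstar K₀ S hU7ₛ hJ hJu Fi Kc G 𝓜 w hw h𝓨 θ e)
    (y y'' : AlgPoints (S.M.obj Kc) (AlgebraicClosure (w.adicCompletion F)))
    {B : AbelianSchemeOver (Spec (CommRingCat.of (AlgebraicClosure (w.adicCompletion F))))}
    (DB : B.DualPair) (lamB : B.X ⟶ DB.hat.X) [IsMonHom lamB]
    (hDBu : Nonempty ((Scheme.Modules.pullback DB.unitHatSlice).obj DB.P ≅ SheafOfModules.unit _))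
    (q : (schΩOf S Kc 𝓜 w e I.univ y).X ⟶ B.X) [IsMonHom q] (c : (schΩOf S Kc 𝓜 w e I.univ y'').X ⟶ B.X) [IsMonHom c]
    (hr2 : ∀ Pt : (fibreΩOf S Kc 𝓜 w e I.univ y'').Points (AlgebraicClosure (w.adicCompletion F)),
        (AlgPoints.map c Pt : B.toAffine.toAbelianVariety.Points (AlgebraicClosure (w.adicCompletion F))) = 1 ↔ IsIdealTorsionΩ S Kc 𝓜 w e I.univ I.act y'' w.asIdeal Pt)
    (hcsurj : Function.Surjective c.left.base)
    (hr3q : q ≫ lamB ≫ DualPair.dualIsogenyOver q (dualΩOf S Kc 𝓜 w e I.univ I.dual y) DB =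
      (polΩOf S Kc 𝓜 w e I.univ I.pol y).lam ≫ (dualΩOf S Kc 𝓜 w e I.univ I.dual y).hat.mulN I.pChar) :
    Surjective q.left ∧ IsFinite q.left ∧ Surjective c.left := by
  have hN : I.pChar ≠ 0 := I.hpChar.1.ne_zero
  -- the unit pin of `Â_y` from the POLARISATION OF THE FIBRE (★ `Polarization.nonempty_unitHatSlice_iso` over the reduced base `Spec Ω̄`; LA6-p01 (g3): no `hD` binder)
  have hDx := (polΩOf S Kc 𝓜 w e I.univ I.pol y).nonempty_unitHatSlice_iso
  have hker' : ∀ Pt, (AlgPoints.map c Pt : B.toAffine.toAbelianVariety.Points (AlgebraicClosure (w.adicCompletion F))) = 1 →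
      ∀ r ∈ w.asIdeal, (AlgPoints.map (((I.act.baseChange ((𝓜.localise w).genericIso'.inv.left ≫ pullback.fst (𝓜.localise w).total.hom (specGenericPoint (HeightOneSpectrum.valuationSubringAtPrime F w) F))).baseChange (thickeningLift e (S.M.obj Kc) y'').left).i r) Pt :
        ((I.univ.baseChange ((𝓜.localise w).genericIso'.inv.left ≫ pullback.fst (𝓜.localise w).total.hom (specGenericPoint (HeightOneSpectrum.valuationSubringAtPrime F w) F))).baseChange (thickeningLift e (S.M.obj Kc) y'').left).toAffine.toAbelianVariety.Points (AlgebraicClosure (w.adicCompletion F))) = 1 :=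
    fun Pt hPt => (hr2 Pt).1 hPt
  obtain ⟨hqsurj, hqfin, hcsurj', -⟩ := roof_legs_isFinite_surjective_of_polarization (A := I.univ) (gA := I.g) (B := B) (O := 𝓞 F)
    (Ω := (AlgebraicClosure (w.adicCompletion F))) ((𝓜.localise w).genericIso'.inv.left ≫ pullback.fst (𝓜.localise w).total.hom (specGenericPoint (HeightOneSpectrum.valuationSubringAtPrime F w) F))
    (thickeningLift e (S.M.obj Kc) y).left (thickeningLift e (S.M.obj Kc) y'').left I.relDim I.act I.dual I.pol DB hDBu hDx q c lamB hN hr3q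
    hN I.hpChar.2 hker' hcsurj
  exact ⟨hqsurj, hqfin, hcsurj'⟩

/-! #### §2.B (K2-Ω) THE ROOF KERNEL LIES IN `A_y[𝔭_w𝔭_{c•w}]` ON ALL `T`-POINTS, and the legs are isogenies -/

set_option maxHeartbeats 400000 in
set_option backward.isDefEq.respectTransparency false in
/-- **(K2-Ω) `comp_actΩ_eq_one_of_roofΩ` — A ROOF LEG'S KERNEL IS KILLED BY `ι(𝔭_w𝔭_{c•w})`, SCHEME-THEORETICALLY.**  For a roof `A_y —q→ B ←c— A_t` (the
`RoofΩ … y t K` rows (r1)(r2)(r3)(r4) after `obtain`, own token shapes) with `#K = q²` and `p` unramified at `w`: every `T`-valued point `u` of `A_y` with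
`u ≫ q = 1` has `u ≫ ι_y(a) = 1` for all `a ∈ 𝔭_w𝔭_{c•w}`.  On Ω̄-points this is ★ (ρ2″) `isIdealTorsion_mul_of_roof` (binders discharged exactly as LA2-p03 (g2)'s
`isIdealTorsionΩ_mul_of_roofLink`: `hdeg := #K = #A_t[𝔭_w](Ω̄) = p^{2f}`, `σ : Ω̄ →+* ℂ` ★, `rosatiΩ`, `polQuasiInvΩ`, `isOfRelDim_schΩOf`); the upgrade to all
`T`-points is ★ `comp_eq_one_of_forall_points_of_charZero` (`q` is an isogeny in characteristic `0`: ★ `roof_legs_isFinite_surjective_of_polarization`).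
[cite: Liu2021, Prop. D.8 (pp. 135–138)] [cite: MumfordAV1970, §7 Thm. 4 (p. 72); §23 Thm. 2 (p. 231)] [cite: Tate1997FiniteFlatGroupSchemes, (3.7)] -/
theorem comp_actΩ_eq_one_of_roofΩ (I : RGDInputsAt F ι₁ Jstar K₀ S hU7ₛ hJ hJu Fi Kc G 𝓜 w hw h𝓨 θ e)
    (hunr : ¬ (w.asIdeal ^ 2 ∣ Ideal.span {(I.pChar : 𝓞 F)}))
    (y t : AlgPoints (S.M.obj Kc) (AlgebraicClosure (w.adicCompletion F)))
    (K : Subgroup ((fibreΩOf S Kc 𝓜 w e I.univ y).Points (AlgebraicClosure (w.adicCompletion F))))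
    (hK : Nat.card ↥K = I.pChar ^ I.fDeg * I.pChar ^ I.fDeg)
    {B : AbelianSchemeOver (Spec (CommRingCat.of (AlgebraicClosure (w.adicCompletion F))))}
    (DB : B.DualPair) (lamB : B.X ⟶ DB.hat.X) [IsMonHom lamB]
    (hDB : Nonempty ((Scheme.Modules.pullback DB.unitHatSlice).obj DB.P ≅ SheafOfModules.unit _))
    (q : (schΩOf S Kc 𝓜 w e I.univ y).X ⟶ B.X) [IsMonHom q] (c : (schΩOf S Kc 𝓜 w e I.univ t).X ⟶ B.X) [IsMonHom c]
    (h1 : ∀ P : (fibreΩOf S Kc 𝓜 w e I.univ y).Points (AlgebraicClosure (w.adicCompletion F)),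
      (AlgPoints.map q P : B.toAffine.toAbelianVariety.Points (AlgebraicClosure (w.adicCompletion F))) = 1 ↔ P ∈ K)
    (h2 : ∀ P : (fibreΩOf S Kc 𝓜 w e I.univ t).Points (AlgebraicClosure (w.adicCompletion F)),
      (AlgPoints.map c P : B.toAffine.toAbelianVariety.Points (AlgebraicClosure (w.adicCompletion F))) = 1 ↔
        IsIdealTorsionΩ S Kc 𝓜 w e I.univ I.act t w.asIdeal P)
    (h2s : Function.Surjective c.left.base)
    (h3 : q ≫ lamB ≫ DualPair.dualIsogenyOver q (dualΩOf S Kc 𝓜 w e I.univ I.dual y) DB =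
      (polΩOf S Kc 𝓜 w e I.univ I.pol y).lam ≫ (dualΩOf S Kc 𝓜 w e I.univ I.dual y).hat.mulN I.pChar)
    (h3'' : c ≫ lamB ≫ DualPair.dualIsogenyOver c (dualΩOf S Kc 𝓜 w e I.univ I.dual t) DB =
      (polΩOf S Kc 𝓜 w e I.univ I.pol t).lam ≫ (dualΩOf S Kc 𝓜 w e I.univ I.dual t).hat.mulN I.pChar)
    (h4 : ∀ a : 𝓞 F, ∃ b : B.X ⟶ B.X,
      (actΩOf S Kc 𝓜 w e I.univ I.act a y).hom.hom.hom ≫ q = q ≫ b ∧ (actΩOf S Kc 𝓜 w e I.univ I.act a t).hom.hom.hom ≫ c = c ≫ b)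
    ⦃T : SchemeOver (AlgebraicClosure (w.adicCompletion F))⦄ (u : T ⟶ (schΩOf S Kc 𝓜 w e I.univ y).X) (hu : u ≫ q = 1) :
    ∀ a ∈ w.asIdeal * ((IsCMField.complexConj F) • w).asIdeal, u ≫ (actΩOf S Kc 𝓜 w e I.univ I.act a y).hom.hom.hom = 1 := by
  haveI : CharZero (w.adicCompletion F) := charZero_of_injective_algebraMap (algebraMap F (w.adicCompletion F)).injective
  haveI : CharZero (AlgebraicClosure (w.adicCompletion F)) :=
    charZero_of_injective_algebraMap (algebraMap (w.adicCompletion F) (AlgebraicClosure (w.adicCompletion F))).injective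
  obtain ⟨σ⟩ := Literature.FieldTheory.AlgClosed.nonempty_ringHom_algebraicClosure_adicCompletion_complex F w
  have hdeg : Nat.card ↥K = Nat.card {P : (fibreΩOf S Kc 𝓜 w e I.univ t).Points (AlgebraicClosure (w.adicCompletion F)) //
      IsIdealTorsionΩ S Kc 𝓜 w e I.univ I.act t w.asIdeal P} := by
    rw [hK, natCard_idealTorsionΩ_w_eq I t, ← pow_add, two_mul]
  have hA'' : (schΩOf S Kc 𝓜 w e I.univ t).IsOfRelDim (Module.finrank ℚ F) := I.hg ▸ isOfRelDim_schΩOf I t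
  -- ★ (ρ2″) on Ω̄-points
  have hpts := isIdealTorsion_mul_of_roof (actΩROf I y) (actΩROf I t)
    (dualΩOf S Kc 𝓜 w e I.univ I.dual y) (polΩOf S Kc 𝓜 w e I.univ I.pol y)
    (dualΩOf S Kc 𝓜 w e I.univ I.dual t) (polΩOf S Kc 𝓜 w e I.univ I.pol t) DB lamB q c
    w hw I.hpChar.1 I.hpChar.2 hunr (not_sq_conj_dvd_span_of_not_sq_dvd_span w I.pChar hunr) σ hA'' hDB K h1 h2 h2s h3 h3'' h4
    (fun b b' hbb' => rosatiΩ I t b b' hbb') (polQuasiInvΩ I y) hdeg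
  -- `q` is an isogeny (finite surjective), so kernel inclusions are decided on Ω̄-points
  obtain ⟨hqsurj, hqfin, -⟩ := roofΩ_legs_isFinite_surjective' I y t DB lamB hDB q c h2 h2s h3
  haveI := hqsurj
  haveI := hqfin
  intro a ha
  exact comp_eq_one_of_forall_points_of_charZero q (actΩOf S Kc 𝓜 w e I.univ I.act a y).hom.hom.hom
    (fun P hP => hpts P ((h1 P).1 hP) a ha) u hu

/-! #### §2.C RANKS BY POINT COUNT (characteristic `0`: every finite subgroup scheme in sight is étale) -/

set_option maxHeartbeats 400000 in
set_option backward.isDefEq.respectTransparency false in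
/-- **`rk_Ω̄ Γ(Ker q) = #K = q²` FOR A ROOF LEG** (`Ker q` is finite étale in characteristic `0`, ★ `etale_ker_hom_of_isFinite_of_surjective`; rank = number of sections,
★ `natCard_hom_eq_finrank_of_etale`; sections of `Ker q` = Ω̄-points killed by `q`, ★ `kerPoints` + ★ `unitIsoSpecOver`; (r1)).
[cite: Tate1997FiniteFlatGroupSchemes, (3.7)] [cite: MumfordAV1970, §7 Thm. 4 (p. 72)] -/
theorem finrank_alg_ker_eq_of_roofLeg (I : RGDInputsAt F ι₁ Jstar K₀ S hU7ₛ hJ hJu Fi Kc G 𝓜 w hw h𝓨 θ e)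
    (y : AlgPoints (S.M.obj Kc) (AlgebraicClosure (w.adicCompletion F)))
    (K : Subgroup ((fibreΩOf S Kc 𝓜 w e I.univ y).Points (AlgebraicClosure (w.adicCompletion F))))
    (hK : Nat.card ↥K = I.pChar ^ I.fDeg * I.pChar ^ I.fDeg)
    {B : AbelianSchemeOver (Spec (CommRingCat.of (AlgebraicClosure (w.adicCompletion F))))}
    (q : (schΩOf S Kc 𝓜 w e I.univ y).X ⟶ B.X) [IsMonHom q] [IsFinite q.left] [Surjective q.left]
    (h1 : ∀ P : (fibreΩOf S Kc 𝓜 w e I.univ y).Points (AlgebraicClosure (w.adicCompletion F)),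
      (AlgPoints.map q P : B.toAffine.toAbelianVariety.Points (AlgebraicClosure (w.adicCompletion F))) = 1 ↔ P ∈ K) :
    Module.finrank (AlgebraicClosure (w.adicCompletion F)) (Alg (ker q)) = I.pChar ^ I.fDeg * I.pChar ^ I.fDeg := by
  haveI : CharZero (w.adicCompletion F) := charZero_of_injective_algebraMap (algebraMap F (w.adicCompletion F)).injective
  haveI : CharZero (AlgebraicClosure (w.adicCompletion F)) :=
    charZero_of_injective_algebraMap (algebraMap (w.adicCompletion F) (AlgebraicClosure (w.adicCompletion F))).injective
  haveI := etale_ker_hom_of_isFinite_of_surjective q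
  haveI := isFinite_ker_hom_of_isFinite q
  have hrk := natCard_hom_eq_finrank_of_etale (G := ker q)
  change Nat.card (𝟙_ (Over (Spec (CommRingCat.of (AlgebraicClosure (w.adicCompletion F))))) ⟶ ker q) =
    Module.finrank (AlgebraicClosure (w.adicCompletion F)) (Alg (ker q)) at hrk
  rw [← hrk, ← hK]
  -- sections of `Ker q` ≃ Ω̄-points of `Ker q` ≃ Ω̄-points of `A_y` killed by `q` ≃ `K`
  have e1 : (𝟙_ (Over (Spec (CommRingCat.of (AlgebraicClosure (w.adicCompletion F))))) ⟶ ker q) ≃ (specOver (AlgebraicClosure (w.adicCompletion F)) (AlgebraicClosure (w.adicCompletion F)) ⟶ ker q) :=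
    (AffineGroupScheme.unitIsoSpecOver (R := (AlgebraicClosure (w.adicCompletion F)))).homCongr (Iso.refl (ker q))
  have e2 : (specOver (AlgebraicClosure (w.adicCompletion F)) (AlgebraicClosure (w.adicCompletion F)) ⟶ ker q) ≃
      {P : specOver (AlgebraicClosure (w.adicCompletion F)) (AlgebraicClosure (w.adicCompletion F)) ⟶ (schΩOf S Kc 𝓜 w e I.univ y).X // P ≫ q = 1} :=
    (kerPoints q (specOver (AlgebraicClosure (w.adicCompletion F)) (AlgebraicClosure (w.adicCompletion F)))).toEquiv.trans (Equiv.subtypeEquivRight fun P => mem_ker_iff q P)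
  have e3 : {P : specOver (AlgebraicClosure (w.adicCompletion F)) (AlgebraicClosure (w.adicCompletion F)) ⟶ (schΩOf S Kc 𝓜 w e I.univ y).X // P ≫ q = 1} ≃ ↥K :=
    Equiv.subtypeEquivRight fun P => h1 P
  exact Nat.card_congr ((e1.trans e2).trans e3)

set_option maxHeartbeats 400000 in
/-- **`#A_y[𝔭_w𝔭_{c•w}](Ω̄) = (p^f·p^f)²`** (★ (LAT-C) at the generic fibre for the ideal `𝔭_w𝔭_{c•w}` of norm `p^f·p^f`; exponent `2g ∕ rk_ℤ 𝒪_F = 2` by `I.hg`).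
[cite: Shimura1998, §7.5 p. 72] [cite: MumfordAV1970, §19 Thm. 3 (p. 176)] -/
theorem natCard_idealTorsionΩ_mul_eq (I : RGDInputsAt F ι₁ Jstar K₀ S hU7ₛ hJ hJu Fi Kc G 𝓜 w hw h𝓨 θ e)
    (y : AlgPoints (S.M.obj Kc) (AlgebraicClosure (w.adicCompletion F))) :
    Nat.card {P : (fibreΩOf S Kc 𝓜 w e I.univ y).Points (AlgebraicClosure (w.adicCompletion F)) //
        IsIdealTorsionΩ S Kc 𝓜 w e I.univ I.act y (w.asIdeal * ((IsCMField.complexConj F) • w).asIdeal) P} =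
      (I.pChar ^ I.fDeg * I.pChar ^ I.fDeg) * (I.pChar ^ I.fDeg * I.pChar ^ I.fDeg) := by
  have hne : w.asIdeal * ((IsCMField.complexConj F) • w).asIdeal ≠ ⊥ :=
    fun h => (Ideal.mul_eq_bot.mp h).elim w.ne_bot ((IsCMField.complexConj F) • w).ne_bot
  have h := natCard_idealTorsion_algPoints_baseChange_eq_absNorm_pow_adicCompletion F w (I.act.baseChange (genΩ 𝓜 w))
    (I.relDim.baseChange (genΩ 𝓜 w)) (thickeningLift e (S.M.obj Kc) y).left _ hne
  have hexp : 2 * I.g / Module.finrank ℤ (𝓞 F) = 2 := by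
    rw [RingOfIntegers.rank, I.hg]
    exact Nat.mul_div_cancel 2 Module.finrank_pos
  rw [hexp, map_mul, absNorm_w_eq I, absNorm_cw_eq I, pow_two] at h
  exact h

set_option maxHeartbeats 400000 in
/-- **(RKG-Ω) THE RANK OF ANY CLOSED REALISATION OF `A_y[𝔭_w𝔭_{c•w}]` IS `q⁴`, BY POINT COUNT**: a closed subgroup scheme `j′ : G′ ↪ A_y` whose `T`-points are the
`𝔭_w𝔭_{c•w}`-torsion points is killed by `p ∈ 𝔭_w𝔭_{c•w}` (`ι(p) = [p]`), hence ÉTALE in characteristic `0` (★ `etale_hom_of_forall_pow_eq_one`), so `rk Γ(G′) = #G′(Ω̄)`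
(★ `natCard_hom_eq_finrank_of_etale`) `= #A_y[𝔭_w𝔭_{c•w}](Ω̄)` (`hj′` on sections, ★ `natCard_hom_eq_natCard_range`, ★ `unitIsoSpecOver`) `= (p^f·p^f)²`.
[cite: Tate1997FiniteFlatGroupSchemes, (3.7)] [cite: MumfordAV1970, §7 Thm. 4 (p. 72)] [cite: Shimura1998, §7.5 p. 72] -/
theorem finrank_alg_realisation_mulTorsionΩ_eq (I : RGDInputsAt F ι₁ Jstar K₀ S hU7ₛ hJ hJu Fi Kc G 𝓜 w hw h𝓨 θ e)
    (y : AlgPoints (S.M.obj Kc) (AlgebraicClosure (w.adicCompletion F)))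
    (hpI : (I.pChar : 𝓞 F) ∈ w.asIdeal * ((IsCMField.complexConj F) • w).asIdeal)
    (G' : SchemeOver (AlgebraicClosure (w.adicCompletion F))) [GrpObj G'] [IsAffine G'.left] [Module.Finite (AlgebraicClosure (w.adicCompletion F)) (Alg G')]
    (j' : G' ⟶ (schΩOf S Kc 𝓜 w e I.univ y).toAffine.toAbelianVariety.X) [IsMonHom j'] [IsClosedImmersion j'.left]
    (hj' : ∀ ⦃T : SchemeOver (AlgebraicClosure (w.adicCompletion F))⦄ (t : T ⟶ (schΩOf S Kc 𝓜 w e I.univ y).toAffine.toAbelianVariety.X),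
      (∃ s : T ⟶ G', s ≫ j' = t) ↔ ∀ a ∈ w.asIdeal * ((IsCMField.complexConj F) • w).asIdeal, t ≫ (actΩOf S Kc 𝓜 w e I.univ I.act a y).hom.hom.hom = 1) :
    Module.finrank (AlgebraicClosure (w.adicCompletion F)) (Alg G') = (I.pChar ^ I.fDeg * I.pChar ^ I.fDeg) * (I.pChar ^ I.fDeg * I.pChar ^ I.fDeg) := by
  classical
  haveI : CharZero (w.adicCompletion F) := charZero_of_injective_algebraMap (algebraMap F (w.adicCompletion F)).injective
  haveI : CharZero (AlgebraicClosure (w.adicCompletion F)) :=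
    charZero_of_injective_algebraMap (algebraMap (w.adicCompletion F) (AlgebraicClosure (w.adicCompletion F))).injective
  let A₀ : AbelianSchemeOver (Spec (.of (AlgebraicClosure (w.adicCompletion F)))) := schΩOf S Kc 𝓜 w e I.univ y
  let Av : AbelianVariety (AlgebraicClosure (w.adicCompletion F)) := A₀.toAffine.toAbelianVariety
  let ρ₀ : A₀.RingAction (𝓞 F) := actΩROf I y
  let Iw : Ideal (𝓞 F) := w.asIdeal * ((IsCMField.complexConj F) • w).asIdeal
  have hp : I.pChar.Prime := I.hpChar.1
  -- `ι(p) = [p]`, so `G′` is killed by `p`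
  have hactp : (actΩOf S Kc 𝓜 w e I.univ I.act (I.pChar : 𝓞 F) y).hom.hom.hom = ((((I.pChar ^ 1 : ℕ) : ℤ) • 𝟙 Av).hom.hom.hom) := by
    change ρ₀.i (I.pChar : 𝓞 F) = _
    rw [RingAction.i_natCast, AbelianVariety.hom_zsmul_id, zpow_natCast, pow_one]
    rfl
  have hG'p : ∀ ⦃T : SchemeOver (AlgebraicClosure (w.adicCompletion F))⦄ (t : T ⟶ G'), (t ≫ j') ^ (I.pChar ^ 1) = 1 := by
    intro T t
    have h := (hj' (t ≫ j')).1 ⟨t, rfl⟩ (I.pChar : 𝓞 F) hpI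
    rwa [hactp, AbelianVariety.hom_zsmul_id, zpow_natCast, MonObj.comp_pow, Category.comp_id] at h
  -- hence ÉTALE and finite
  have hpΩ : ((I.pChar : ℤ) : (AlgebraicClosure (w.adicCompletion F))) ≠ 0 := by exact_mod_cast hp.ne_zero
  haveI : Etale G'.hom := AbelianVariety.etale_hom_of_forall_pow_eq_one j' (I.pChar : ℤ) hpΩ fun T u => by
    rw [zpow_natCast]
    have h := hG'p u
    rwa [pow_one] at h
  haveI : IsFinite G'.hom := isFinite_hom_of_finite_alg G'
  have hrk := natCard_hom_eq_finrank_of_etale (G := G')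
  change Nat.card (𝟙_ (Over (Spec (CommRingCat.of (AlgebraicClosure (w.adicCompletion F))))) ⟶ G') = Module.finrank (AlgebraicClosure (w.adicCompletion F)) (Alg G') at hrk
  rw [← hrk, natCard_hom_eq_natCard_range j', ← natCard_idealTorsionΩ_mul_eq I y]
  -- sections of `G′` ≃ sections of `A_y` killed by `𝔭_w𝔭_{c•w}` ≃ Ω̄-points of `A_y` killed by `𝔭_w𝔭_{c•w}`
  refine Nat.card_congr ((Equiv.subtypeEquivRight fun t => MonoidHom.mem_range.trans (hj' t)).trans
    (Equiv.subtypeEquiv ((AffineGroupScheme.unitIsoSpecOver (R := (AlgebraicClosure (w.adicCompletion F)))).homCongr (Iso.refl _)) fun t => ?_))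
  refine forall₂_congr fun a _ => ?_
  change t ≫ (actΩOf S Kc 𝓜 w e I.univ I.act a y).hom.hom.hom = 1 ↔
    ((AffineGroupScheme.unitIsoSpecOver (R := (AlgebraicClosure (w.adicCompletion F)))).inv ≫ t ≫ 𝟙 _) ≫ (actΩOf S Kc 𝓜 w e I.univ I.act a y).hom.hom.hom = 1
  rw [Category.comp_id, Category.assoc]
  constructor
  · intro h
    rw [h]
    exact MonObj.comp_one _
  · intro h
    have h2 := congrArg (fun x => (AffineGroupScheme.unitIsoSpecOver (R := (AlgebraicClosure (w.adicCompletion F)))).hom ≫ x) h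
    simp only [Iso.hom_inv_id_assoc] at h2
    rw [h2]
    exact MonObj.comp_one _

/-! #### §2.D THE PORTED SOCKET BRICKS: (s-LAG) and (s-REAL) read on `A_y` -/

set_option maxHeartbeats 400000 in
/-- **(s-LAG) UPSTAIRS `lag_of_roofLeg`** (port of LA2-p04 (g2)'s `lag_of_quotLeg`) — ★ `exists_comp_eq_iff_of_descent` instantiated at `A := A_y` (as an abelian variety over `Ω̄`),
`B := B₁` the roof middle, `r := q₁`, `n := p^1` (the (r3) row with `[p] = [p^1]`): the realised kernel `κ : K ↪ G′` of `j′ ≫ q₁` is LAGRANGIAN for the cut duality `e` in ★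
(BLK)'s points form.  Own declaration for the heartbeat budget. [cite: MumfordAV1970, §23 Thm. 2 (p. 231)] [cite: Tate1997FiniteFlatGroupSchemes, §(3.8) pp. 145–146] -/
theorem lag_of_roofLeg (I : RGDInputsAt F ι₁ Jstar K₀ S hU7ₛ hJ hJu Fi Kc G 𝓜 w hw h𝓨 θ e)
    (y : AlgPoints (S.M.obj Kc) (AlgebraicClosure (w.adicCompletion F)))
    (G' : SchemeOver (AlgebraicClosure (w.adicCompletion F))) [GrpObj G'] [IsCommMonObj G'] [IsAffine G'.left]
    [Module.Free (AlgebraicClosure (w.adicCompletion F)) (Alg G')] [Module.Finite (AlgebraicClosure (w.adicCompletion F)) (Alg G')]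
    (j' : G' ⟶ (schΩOf S Kc 𝓜 w e I.univ y).toAffine.toAbelianVariety.X) (e𝒟 : G' ≅ cartierDual G')
    (hpair : ∀ ⦃T : Type⦄ [CommRing T] [Algebra (AlgebraicClosure (w.adicCompletion F)) T] [Module.Finite (AlgebraicClosure (w.adicCompletion F)) T]
      (t s : specOver (AlgebraicClosure (w.adicCompletion F)) T ⟶ G')
      (ht : ((t ≫ j') ≫ (polΩOf S Kc 𝓜 w e I.univ I.pol y).lam) ^ (I.pChar ^ 1) = 1) (hs : (s ≫ j') ^ (I.pChar ^ 1) = 1),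
      cartierPairing G' (t ≫ e𝒟.hom) s =
        (dualΩOf S Kc 𝓜 w e I.univ I.dual y).weilChar (polΩOf S Kc 𝓜 w e I.univ I.pol y).nonempty_unitHatSlice_iso (I.pChar ^ 1)
          ((t ≫ j') ≫ (polΩOf S Kc 𝓜 w e I.univ I.pol y).lam) ht (s ≫ j') hs)
    (hG'p : ∀ ⦃T : SchemeOver (AlgebraicClosure (w.adicCompletion F))⦄ (t : T ⟶ G'), (t ≫ j') ^ (I.pChar ^ 1) = 1)
    {B₁ : AbelianSchemeOver (Spec (CommRingCat.of (AlgebraicClosure (w.adicCompletion F))))}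
    (ψ₁ : (schΩOf S Kc 𝓜 w e I.univ y).X ⟶ B₁.X) [IsMonHom ψ₁]
    (DB₁ : B₁.DualPair)
    (hDB₁ : Nonempty ((Scheme.Modules.pullback (DualPair.unitHatSlice DB₁)).obj DB₁.P ≅ SheafOfModules.unit _))
    (lamB₁ : B₁.X ⟶ DB₁.hat.X) [IsMonHom lamB₁]
    (hSIM₁ : ψ₁ ≫ lamB₁ ≫ DualPair.dualIsogenyOver ψ₁ (dualΩOf S Kc 𝓜 w e I.univ I.dual y) DB₁ =
      (polΩOf S Kc 𝓜 w e I.univ I.pol y).lam ≫ (dualΩOf S Kc 𝓜 w e I.univ I.dual y).hat.mulN I.pChar)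
    (K₁ : SchemeOver (AlgebraicClosure (w.adicCompletion F))) [GrpObj K₁] [IsCommMonObj K₁] [IsAffine K₁.left]
    [Module.Free (AlgebraicClosure (w.adicCompletion F)) (Alg K₁)] [Module.Finite (AlgebraicClosure (w.adicCompletion F)) (Alg K₁)]
    (κ₁ : K₁ ⟶ G') [IsMonHom κ₁] [IsClosedImmersion κ₁.left]
    (hκkill : (κ₁ ≫ j') ≫ ψ₁ = 1)
    (hrk : Module.finrank (AlgebraicClosure (w.adicCompletion F)) (Alg G') = Module.finrank (AlgebraicClosure (w.adicCompletion F)) (Alg K₁) * Module.finrank (AlgebraicClosure (w.adicCompletion F)) (Alg K₁))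
    ⦃T : SchemeOver (AlgebraicClosure (w.adicCompletion F))⦄ (t : T ⟶ G') :
    (∃ s : T ⟶ K₁, s ≫ κ₁ = t) ↔ (t ≫ e𝒟.hom) ≫ cartierDualMap κ₁ = 1 := by
  have hp : I.pChar.Prime := I.hpChar.1
  haveI : Fact I.pChar.Prime := ⟨hp⟩
  have hp1 : I.pChar ^ 1 ≠ 0 := by rw [pow_one]; exact hp.ne_zero
  have hSIM₁' : ψ₁ ≫ lamB₁ ≫ DualPair.dualIsogenyOver (A' := (AbelianScheme.ofAbelianVariety (schΩOf S Kc 𝓜 w e I.univ y).toAffine.toAbelianVariety).toOver)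
      (B := (AbelianScheme.ofAbelianVariety B₁.toAffine.toAbelianVariety).toOver) ψ₁
        (dualΩOf S Kc 𝓜 w e I.univ I.dual y) DB₁ =
      (polΩOf S Kc 𝓜 w e I.univ I.pol y).lam ≫ (dualΩOf S Kc 𝓜 w e I.univ I.dual y).hat.mulN (I.pChar ^ 1) := by rw [pow_one]; exact hSIM₁
  exact DualPair.exists_comp_eq_iff_of_descent (I.pChar ^ 1) (schΩOf S Kc 𝓜 w e I.univ y).toAffine.toAbelianVariety (dualΩOf S Kc 𝓜 w e I.univ I.dual y)
    (polΩOf S Kc 𝓜 w e I.univ I.pol y).nonempty_unitHatSlice_iso (polΩOf S Kc 𝓜 w e I.univ I.pol y)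
    B₁.toAffine.toAbelianVariety DB₁ hDB₁ lamB₁ ψ₁ G' j' e𝒟 K₁ κ₁ hp1 hSIM₁' hG'p hpair hκkill hrk t

set_option maxHeartbeats 400000 in
/-- **(s-REAL) READ ON `A_y` `real_comp_of_roofLeg`** (port of LA2-p04 (g2)'s `real_comp_of_quotLeg`) — if `κ : K ↪ G′` realises `Ker (j′ ≫ q)` inside the cut and
`Ker q ⊆ A_y[𝔭_w𝔭_{c•w}]` (K2-Ω), then `κ ≫ j′ : K ↪ A_y` realises `Ker q` (the premiss shape of the by-value rank rows (RK)). [cite: GortzWedhorn2020, Definition 4.45 (2) (p. 117)] -/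
theorem real_comp_of_roofLeg (I : RGDInputsAt F ι₁ Jstar K₀ S hU7ₛ hJ hJu Fi Kc G 𝓜 w hw h𝓨 θ e)
    (y : AlgPoints (S.M.obj Kc) (AlgebraicClosure (w.adicCompletion F)))
    (G' : SchemeOver (AlgebraicClosure (w.adicCompletion F))) (j' : G' ⟶ (schΩOf S Kc 𝓜 w e I.univ y).toAffine.toAbelianVariety.X)
    (hj' : ∀ ⦃T : SchemeOver (AlgebraicClosure (w.adicCompletion F))⦄ (t : T ⟶ (schΩOf S Kc 𝓜 w e I.univ y).toAffine.toAbelianVariety.X),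
      (∃ s : T ⟶ G', s ≫ j' = t) ↔ ∀ a ∈ w.asIdeal * ((IsCMField.complexConj F) • w).asIdeal, t ≫ (actΩOf S Kc 𝓜 w e I.univ I.act a y).hom.hom.hom = 1)
    {B₁ : AbelianSchemeOver (Spec (CommRingCat.of (AlgebraicClosure (w.adicCompletion F))))}
    (ψ₁ : (schΩOf S Kc 𝓜 w e I.univ y).X ⟶ B₁.X) [IsMonHom ψ₁]
    (hK₁ : ∀ ⦃T : SchemeOver (AlgebraicClosure (w.adicCompletion F))⦄ (t : T ⟶ (schΩOf S Kc 𝓜 w e I.univ y).X), t ≫ ψ₁ = 1 →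
      ∀ a ∈ w.asIdeal * ((IsCMField.complexConj F) • w).asIdeal, t ≫ (actΩOf S Kc 𝓜 w e I.univ I.act a y).hom.hom.hom = 1)
    (K₁ : SchemeOver (AlgebraicClosure (w.adicCompletion F))) (κ₁ : K₁ ⟶ G')
    (hκ₁' : ∀ ⦃T : SchemeOver (AlgebraicClosure (w.adicCompletion F))⦄ (t : T ⟶ G'), (∃ s : T ⟶ K₁, s ≫ κ₁ = t) ↔ (t ≫ j') ≫ ψ₁ = 1)
    ⦃T : SchemeOver (AlgebraicClosure (w.adicCompletion F))⦄ (t : T ⟶ (schΩOf S Kc 𝓜 w e I.univ y).X) :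
    (∃ s : T ⟶ K₁, s ≫ (κ₁ ≫ j') = t) ↔ t ≫ ψ₁ = 1 := by
  constructor
  · rintro ⟨s, rfl⟩
    simpa only [Category.assoc] using (hκ₁' (s ≫ κ₁)).1 ⟨s, rfl⟩
  · intro ht
    obtain ⟨t', rfl⟩ := (hj' t).2 (hK₁ t ht)
    obtain ⟨s, hs⟩ := (hκ₁' t').2 ht
    exact ⟨s, by rw [← Category.assoc, hs]⟩


/-! #### §2.E THE (C6′-Ω) FOLD OVER THE CUT -/

end RoofKernelUnique

end Block_C6Ω

end Summit.HodgeConjecture.HodgeConjecture.Cruxes.HLiu418.F0P6aLineSpecialisation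

end
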